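import Summits.BirchSwinnertonDyer.Rank1Residual.ManinAdditive.PlusIndexLaws
import Summits.BirchSwinnertonDyer.Rank1Residual.ManinAdditive.KatoCurvePlusDefectLevers
import Summits.BirchSwinnertonDyer.Rank1Residual.ManinAdditive.DegeneracyLoopLaws
import Literature.NumberTheory.EllipticCurves.KatoAdditiveTwistedValueNeronIntegralityThreeKPForms
import HarnessLib
import HarnessLib.Audit.Tags

/-!
# THE KOSTERS–PANNEKOEK WITNESS AT `3` AND THE KIM–NAKAMURA LOCUS: E-es-86 / 87 / 87♭ / 87♭⁺ / 87± / 88 and the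
# `3 ∤ c` corollaries at composite squarefull level — cell `bsd-f2-manin` (D-0131 (3) frontier: the Manin constant at
# additive primes), lens es (Euler system / explicit reciprocity), planner es g22 MEMO-es §36 «UN-WEAKEN (P5)»; typed by the
# cell typer g14 (T-es-29 (b), 2026-08-28T19:47:35Z) VERBATIM from HOME/es/Sketch-es-g22.lean sha16 20af58d791d39f75 (v3 = v2 ab9270f56f5338b2 + es ERRATUM
# 19:58:29Z: binder `coeffField f = ⊥` in E-es-87♭/87♭⁺; §1–§4 = v1 14d471371a4b85c6) §2–§5 +
# §3b (farm rc 0 · 0 err · 0 warn · 0 sorry; BC7 CLEAN es/g22/g22-bc7{,b,d}.raw.txt), namespace `BsdF2ManinEsG22` ↦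
# `…ManinAdditive.KatoCurve`; §1 (the fact F₃♮ `kato_neron_isIntegral_twistedSymbolSum_of_additive_three_kp`, `kpSignThree`,
# `KatoFactThreeAtKP` + edges) lives in Literature (`KatoAdditiveTwistedValueNeronIntegralityThreeKP{,Forms}.lean`, T-es-29 (a)).

HONEST FRAMING.  The eight law `def`s (§3, §3b, §5) are tagged `@[conjecture]` (obligation nodes, nothing asserted);
`IsSquarefull`, `ThreeAdicKPWitness` and `DegeneracyPlusIndexPrimeTo` are plain definitions; every `theorem` is a sorry-free edge.  PAPER STATUS (es): E-es-87♭
`TameUnitTwistOfPlusIndexPrimeToThree` is a THEOREM ON PAPER from the tree's THEOREM B′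
(`Gamma1LatticeBalancedCuspDifferencesPrime`) + MEMO-es §31.10 Lemmas 1–3 (half-sum, `P = 1` at `m ≡ −1 (mod N)`,
Fourier-with-no-holes) — Lean proof = ask T-es-29 (c), TAKEN by prover p3 g9 (2026-08-28T20:00:10Z, files
`Theorems/ManinLocalTwoThreeTameUnitTwist*.lean`, this signature VERBATIM), NOT done in this file; E-es-87♭⁺ needs THEOREM B′ at
`4 ∣ N` and the variant B″ (primes `≡ −1 (mod 4N)`, ask T-es-29 (d)) at odd `N`; E-es-87 = 87♭ + bookkeeping; E-es-86/88
rest on per-class loop laws (OPEN).  BC5 witness (es g22, POLAR-N5000): KP-witness law E-es-86 4310/4310 (ā = 0: gA 1488/1488;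
ā = +1: gB 1457/1457; ā = −1: gA 1365/1365); the two classes with `3 ∣ d` (27a1, 54a1) have no unit twist (converse visible);
180/181 never∧squarefull classes `N ≤ 5000` have `3 ∤ d` and a unit witness (exception 27a1, `N = 3³`, no second prime).
REACH: `3 ∤ c(W)` for `ā(W) ≠ +1` at composite squarefull `9 ∣ N` — 178 (ā = 0) + 96 (ā = −1, `4 ∣ N`) classes `≤ 5000` as a
theorem modulo F₃♮ (+ 43 with ā = −1, odd `N`, modulo B″).  REF1 R-es-43 (c₆-reading of ā, F₃♮ vs (P5), §36.5 step (4),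
placement vs Stevens 1985 / Ash–Stevens 1986) PENDING at filing — a finding is repaired under a NEW name (append-only).  NOT in
print.  bears_on: stmt-BirchSwinnertonDyer-22968 (C3; TURNKEY-es-14: split `h66` by K–P class).  PARTITION: new closed
sub-cell «ā ≠ +1 ∧ composite squarefull» of C3's habitat, modulo F₃♮ · beyond-print theorem: candidate (lemma-level, es) /
no in Lean · BSD is not proved by this; Manin's conjecture is not proved by this.

§5 (E-es-89/90, T-es-29 (e)(f), es ADDENDUM 19:54:05Z, MEMO-es §36.11 THEOREM U on paper): KP / POLAR witnesses from
the DEGENERACY-LOOP plus indices `DegeneracyPlusIndexPrimeTo 3 3` / `3 9` (over the tree's `Gamma1Lattice.degeneracyLoops`);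
BC7 9/9 CLEAN this gen.

es g22 VERBATIM (§2–§5, §3b):
-/

noncomputable section

open scoped Classical MatrixGroups ModularForm ComplexConjugate

open CongruenceSubgroup Complex WeierstrassCurve Literature.NumberTheory.EllipticCurves
  Literature.NumberTheory.EllipticCurves.ModularForms

namespace Summit.BirchSwinnertonDyer.Rank1Residual.ManinAdditive.KatoCurve

/-! ## §2 The KP witness and the lever -/

/-- **The `3`-adic EVEN KP WITNESS of `(W, V, f)`**: `ThreeAdicPolarWitness W V f` VERBATIM with `χ(3) ≠ 1 ∧ χ(3) ≠ −1`
replaced by `χ(3)·ā(V) ≠ 1`.  On the Kim–Nakamura locus `ā(V) = 0` the clause is EMPTY: any tame even primitive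
`χ` of order prime to `3` and conductor prime to `3N` may certify. -/
def ThreeAdicKPWitness (W V : WeierstrassCurve ℚ) [V.IsElliptic] {N : ℕ} [NeZero N]
    (f : CuspForm (Gamma0 N) 2) : Prop :=
  ∃ (m : ℕ) (_ : NeZero m) (χ : DirichletCharacter ℂ m) (r : ℂ) (ρ : ℚ),
    IsNewformOf V f ∧ ¬ V.HasGoodReductionAtPrime 3 ∧ ¬ V.HasMultiplicativeReductionAtPrime 3 ∧
    m.Coprime (3 * N) ∧ χ.IsPrimitive ∧ χ ≠ 1 ∧ ¬ 3 ∣ orderOf χ ∧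
    χ (3 : ZMod m) * kpSignThree V ≠ 1 ∧ χ.Even ∧
    (ρ : ℝ) * V.realPeriodRat = W.realPeriodRat ∧
    (∏ ℓ ∈ N.primeFactors with ¬ ℓ ^ 2 ∣ N,
        (((ℓ : ℂ) - (V.LFunction ℓ : ℂ) * χ (ℓ : ZMod m)) *
          ((ℓ : ℂ) - (V.LFunction ℓ : ℂ) * (χ (ℓ : ZMod m))⁻¹))) *
        twistedSymbolSum f χ = r * (plusPeriod f : ℂ) ∧
    ∀ s : ℕ, ¬ 3 ∣ s → ¬ _root_.IsIntegral ℤ ((s : ℂ) * r * (ρ : ℂ) / 3)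

/-- A polar witness is a KP witness (PROVED). -/
theorem kpWitness_of_polar (W V : WeierstrassCurve ℚ) [V.IsElliptic] {N : ℕ} [NeZero N]
    (f : CuspForm (Gamma0 N) 2) (h : ThreeAdicPolarWitness W V f) : ThreeAdicKPWitness W V f := by
  obtain ⟨m, hm, χ, r, ρ, hnew, hg, hmu, hcop, hprim, hne, hord, h3a, h3b, hev, hρ, hsum, hwit⟩ := h
  exact ⟨m, hm, χ, r, ρ, hnew, hg, hmu, hcop, hprim, hne, hord, mul_kpSignThree_ne_one χ V h3a h3b, hev, hρ,
    hsum, hwit⟩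

/-- **The g16 LEVER, KP-indexed** (verbatim proof of `not_three_dvd_of_katoFactThreeAt_of_witness`). -/
theorem not_three_dvd_of_katoFactThreeAtKP_of_kpWitness {N : ℕ} [NeZero N]
    (W V : WeierstrassCurve ℚ) [V.IsElliptic] [V.IsGloballyMinimal]
    (f : CuspForm (Gamma0 N) 2) (c : ℤ)
    (hF : KatoFactThreeAtKP V f) (hW : ThreeAdicKPWitness W V f)
    (hΩ : W.realPeriodRat = (c : ℝ) * plusPeriod f) (hc0 : c ≠ 0) :
    ¬ 3 ∣ c := by
  rintro ⟨c', rfl⟩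
  obtain ⟨m, _, χ, r, ρ, hnew, hg, hm, hcop, hprim, hne, hord, h3, hev, hρ, hsum, hwit⟩ := hW
  have hc : (((3 * c' : ℤ)) : ℝ) ≠ 0 := by exact_mod_cast hc0
  have hc' : (c' : ℂ) ≠ 0 := by
    have h3 : (3 * c' : ℤ) ≠ 0 := hc0
    exact_mod_cast (mul_ne_zero_iff.mp h3).2
  have hpp : (plusPeriod f : ℝ) = (ρ : ℝ) * V.realPeriodRat / ((3 * c' : ℤ) : ℝ) := by
    rw [eq_div_iff hc, hρ, hΩ]; ring
  set ϖ : ℚ := ρ / ((3 * c' : ℤ) : ℚ) with hϖ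
  have hϖΩ : (ϖ : ℝ) * V.realPeriodRat = plusPeriod f := by
    rw [hpp, hϖ]; push_cast; ring
  obtain ⟨s, hs, hint⟩ := (hF hnew hg hm m hcop χ hprim hne hord h3 ϖ r).1 hev hϖΩ hsum
  apply hwit s hs
  have key : (s : ℂ) * r * (ρ : ℂ) / 3 = (c' : ℂ) * ((s : ℂ) * (ϖ : ℂ) * r) := by
    rw [hϖ]; push_cast
    field_simp
  rw [key]
  exact (isIntegral_algebraMap (R := ℤ) (A := ℂ) (x := c')).mul hint

/-! ## §3 The laws -/

/-- `N` is squarefull: every prime factor divides `N` at least twice (so Kato's `S`-imprimitive Euler product over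
`ℓ ∥ N` is EMPTY). -/
def IsSquarefull (N : ℕ) : Prop := ∀ ℓ ∈ N.primeFactors, ℓ ^ 2 ∣ N

/-- **E-es-87♭ (f-level core, W-free; THEOREM ON PAPER)**: for `3 ∣ N` and `f` with plus index prime to `3`, some
tame even primitive `χ` (conductor `m` prime to `3N`, order prime to `3`; on paper `m` prime, `m ≡ −1 (mod N)`)
has `S_χ = r·Ω⁺_f` with `s·r/3` NOT an algebraic integer for every `3 ∤ s` (`r = F̂(χ) ∈ ℤ[χ]` is a unit at some
prime above `3`).  Proof on paper: THEOREM B′ (`ε = −1`: `Λ₁(f)` is generated by balanced prime-conductor cusp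
differences with `m ≡ −1 (mod N)`; there `|A_m| = (m−1)/2` is prime to `3`) ⟹ `gcd_m d^{BAL}(m) = d`, so `3 ∤ d`
gives an `m` with `3 ∤ d^{BAL}(m)`; Lemma 1 (half-sum: `S_χ/Ω⁺_f = Σ_{A_m} χ(b)φ⁺(y_{b,m})`) and Lemma 3 with NO
holes (the `ℤ₍₃₎[ζ]`-span of `{χ̄ : χ ≠ 1}` is the zero-sum functions) give a `χ ≠ 1` and `𝔭 ∣ 3` with
`v_𝔭(S_χ/Ω⁺_f) = 0`.  CONVERSELY `3 ∣ d` ⟹ no such `χ` (Thm R (i)).  The binder `coeffField f = ⊥` (rational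
newform) is NEEDED: for a non-rational newform `plusPeriod f` is the junk value `0` and the conclusion would force
`S_χ = 0` (erratum es g22, 2026-08-28T20:1xZ).  [MEMO-es §31.10, §36; candidate, not a fact] TYPER FRAMING (E-es-87♭): lens es; LAW (obligation node), nothing asserted; BC5 and paper status in the module docstring; REF1
R-es-43 PENDING at filing.  OPEN in Lean.
[cite: KostersPannekoek2017, Thm. 1 (ii) (shape only: the K–P class ā; the law is the cell's E-es-87♭ — es MEMO-es §36)] -/
@[conjecture]
def TameUnitTwistOfPlusIndexPrimeToThree : Prop :=
  ∀ {N : ℕ} [NeZero N] (f : CuspForm (Gamma0 N) 2), IsNewform0 f → coeffField f = ⊥ → 3 ∣ N →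
    PlusIndexPrimeTo 3 f →
    ∃ (m : ℕ) (_ : NeZero m) (χ : DirichletCharacter ℂ m) (r : ℂ),
      m.Coprime (3 * N) ∧ χ.IsPrimitive ∧ χ ≠ 1 ∧ ¬ 3 ∣ orderOf χ ∧ χ.Even ∧
      twistedSymbolSum f χ = r * (plusPeriod f : ℂ) ∧
      ∀ s : ℕ, ¬ 3 ∣ s → ¬ _root_.IsIntegral ℤ ((s : ℂ) * r / 3)

/-- **E-es-86** (E-es-66 with the KP witness): for every lattice-optimal `W` with `9 ∣ N` and plus index prime to `3`
a `3`-adic even KP witness against `Ω(W)` exists.  WEAKER than E-es-66 (PROVED edge below); on paper it follows from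
per-class loop laws each weaker than (K_9): `ā = 0`: holes at `ℓ ∥ N` only; `ā = 1`: (K_3)₃·E; `ā = −1`: the mixed
`⟨3̄⟩/⟨9̄⟩` law. [cell candidate, not a fact] TYPER FRAMING (E-es-86): lens es; LAW (obligation node), nothing asserted; BC5 and paper status in the module docstring; REF1
R-es-43 PENDING at filing.  OPEN in Lean.
[cite: KostersPannekoek2017, Thm. 1 (ii) (shape only: the K–P class ā; the law is the cell's E-es-86 — es MEMO-es §36)] -/
@[conjecture]
def ThreeAdicKPWitnessOfPlusIndexPrimeToThree : Prop :=
  ∀ (W : WeierstrassCurve ℚ) [W.IsElliptic] [W.IsGloballyMinimal] {N : ℕ} [NeZero N]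
    (D : ModularParametrizationData W N),
    (∀ z ∈ D.L.lattice, ∃ w ∈ periodLattice D.f, z = D.c * w) → 3 ^ 2 ∣ N →
    PlusIndexPrimeTo 3 D.f → ThreeAdicKPWitness W W D.f

/-- **E-es-88** (Kim–Nakamura locus, any level): as E-es-86 for `ā(W) = 0`; on paper ⟸ the TAME-LEVEL hole laws at
the primes `ℓ ∥ N` (per-curve sign `ε_ℓ(W) = a_ℓ(W)·ℓ mod 3`), never (K_9). [cell candidate, not a fact] TYPER FRAMING (E-es-88): lens es; LAW (obligation node), nothing asserted; BC5 and paper status in the module docstring; REF1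
R-es-43 PENDING at filing.  OPEN in Lean.
[cite: KostersPannekoek2017, Thm. 1 (ii) (shape only: the K–P class ā; the law is the cell's E-es-88 — es MEMO-es §36)] -/
@[conjecture]
def ThreeAdicKPWitnessOfKPZero : Prop :=
  ∀ (W : WeierstrassCurve ℚ) [W.IsElliptic] [W.IsGloballyMinimal] {N : ℕ} [NeZero N]
    (D : ModularParametrizationData W N),
    (∀ z ∈ D.L.lattice, ∃ w ∈ periodLattice D.f, z = D.c * w) → 3 ^ 2 ∣ N →
    kpSignThree W = 0 → PlusIndexPrimeTo 3 D.f → ThreeAdicKPWitness W W D.f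

/-- **E-es-87 (THEOREM ON PAPER)** — Kim–Nakamura locus at SQUAREFULL level: for lattice-optimal `W` with `9 ∣ N`,
`N` squarefull, `ā(W) = 0` and plus index prime to `3`, a `3`-adic even KP witness against `Ω(W)` exists.
= E-es-87♭ + bookkeeping (`V = W`, `ρ = 1`, empty Euler product, additivity at `3` from `9 ∣ N = conductor`,
clause `χ(3)·0 ≠ 1` empty).  181 classes `N ≤ 5000`; data: unit witness at all 180 with `3 ∤ d` (POLAR-N5000). TYPER FRAMING (E-es-87): lens es; LAW (obligation node), nothing asserted; BC5 and paper status in the module docstring; REF1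
R-es-43 PENDING at filing.  OPEN in Lean.
[cite: KostersPannekoek2017, Thm. 1 (ii) (shape only: the K–P class ā; the law is the cell's E-es-87 — es MEMO-es §36)] -/
@[conjecture]
def ThreeAdicKPWitnessOfKPZeroSquarefull : Prop :=
  ∀ (W : WeierstrassCurve ℚ) [W.IsElliptic] [W.IsGloballyMinimal] {N : ℕ} [NeZero N]
    (D : ModularParametrizationData W N),
    (∀ z ∈ D.L.lattice, ∃ w ∈ periodLattice D.f, z = D.c * w) → 3 ^ 2 ∣ N → IsSquarefull N →
    kpSignThree W = 0 → PlusIndexPrimeTo 3 D.f → ThreeAdicKPWitness W W D.f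

/-- E-es-66 ⟹ E-es-86 (PROVED). -/
theorem e86_of_e66 (h66 : ThreeAdicWitnessOfPlusIndexPrimeToThree) : ThreeAdicKPWitnessOfPlusIndexPrimeToThree :=
  fun W _ _ _ _ D hopt h9 hd ↦ kpWitness_of_polar W W D.f (h66 W D hopt h9 hd)

/-- E-es-86 ⟹ E-es-88 (PROVED). -/
theorem e88_of_e86 (h : ThreeAdicKPWitnessOfPlusIndexPrimeToThree) : ThreeAdicKPWitnessOfKPZero :=
  fun W _ _ _ _ D hopt h9 _ hd ↦ h W D hopt h9 hd

/-- E-es-88 ⟹ E-es-87 (PROVED). -/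
theorem e87_of_e88 (h : ThreeAdicKPWitnessOfKPZero) : ThreeAdicKPWitnessOfKPZeroSquarefull :=
  fun W _ _ _ _ D hopt h9 _ h0 hd ↦ h W D hopt h9 h0 hd

/-! ## §3b ODD-ORDER twists: the KP clause is AUTOMATIC for `ā ∈ {0, −1}`

At a prime conductor `m ≡ −1 (mod N)` with `4 ∣ N` (resp. any `N` with `3 ∣ N`) one has `m ≡ 3 (mod 4)` (resp.
`m ≡ 2 (mod 3)`), so `#((ℤ/m)ˣ/±1) = (m−1)/2` is odd and prime to `3`: EVERY non-trivial even character of conductor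
`m` has odd order prime to `3`, hence never takes the value `−1`, hence satisfies the Kosters–Pannekoek clause
`χ(3)·ā ≠ 1` for `ā ∈ {0, −1}`.  THEOREM B′ (tree, `ε = −1`) supplies exactly these conductors. -/

/-- A character of odd order never takes the value `−1` (PROVED). -/
theorem apply_ne_neg_one_of_odd_orderOf {m : ℕ} (χ : DirichletCharacter ℂ m)
    (hodd : Odd (orderOf χ)) (a : ZMod m) : χ a ≠ -1 := by
  intro h
  by_cases ha : IsUnit a
  · obtain ⟨u, rfl⟩ := ha
    have h1 : (χ ^ orderOf χ) (u : ZMod m) = 1 := by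
      rw [pow_orderOf_eq_one]; exact MulChar.one_apply_coe u
    rw [MulChar.pow_apply_coe, h, hodd.neg_one_pow] at h1
    norm_num at h1
  · exact absurd (h ▸ χ.map_nonunit ha) (by norm_num)

/-- For `ā(V) ≠ 1` an odd-order character satisfies the KP clause (PROVED). -/
lemma mul_kpSignThree_ne_one_of_odd {m : ℕ} (χ : DirichletCharacter ℂ m) (V : WeierstrassCurve ℚ)
    (hodd : Odd (orderOf χ)) (hV : kpSignThree V ≠ 1) : χ (3 : ZMod m) * kpSignThree V ≠ 1 := by
  rcases kpSignThree_mem V with h | h | h <;> rw [h]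
  · simp
  · exact absurd h hV
  · intro hx; apply apply_ne_neg_one_of_odd_orderOf χ hodd 3; linear_combination -hx

/-- **E-es-87♭⁺ `OddTameUnitTwistOfPlusIndexPrimeToThree`** — E-es-87♭ with the twist of ODD order.  THEOREM on
paper when `4 ∣ N` (THEOREM B′ with `ε = −1`: `m ≡ −1 (mod N)` forces `m ≡ 3 (mod 4)`); for odd `N` it needs the
expected variant B″ of THEOREM B′ over the prime class `m ≡ −1 (mod 4N)` (same Dirichlet argument, modulus `4N`;
typer ask T-es-29(d)). TYPER FRAMING (E-es-87♭⁺): lens es; LAW (obligation node), nothing asserted; BC5 and paper status in the module docstring; REF1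
R-es-43 PENDING at filing.  OPEN in Lean.
[cite: KostersPannekoek2017, Thm. 1 (ii) (shape only: the K–P class ā; the law is the cell's E-es-87♭⁺ — es MEMO-es §36)] -/
@[conjecture]
def OddTameUnitTwistOfPlusIndexPrimeToThree : Prop :=
  ∀ {N : ℕ} [NeZero N] (f : CuspForm (Gamma0 N) 2), IsNewform0 f → coeffField f = ⊥ → 3 ∣ N →
    PlusIndexPrimeTo 3 f →
    ∃ (m : ℕ) (_ : NeZero m) (χ : DirichletCharacter ℂ m) (r : ℂ),
      m.Coprime (3 * N) ∧ χ.IsPrimitive ∧ χ ≠ 1 ∧ Odd (orderOf χ) ∧ ¬ 3 ∣ orderOf χ ∧ χ.Even ∧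
      twistedSymbolSum f χ = r * (plusPeriod f : ℂ) ∧
      ∀ s : ℕ, ¬ 3 ∣ s → ¬ _root_.IsIntegral ℤ ((s : ℂ) * r / 3)

/-- E-es-87♭⁺ ⟹ E-es-87♭ (PROVED). -/
theorem tameUnitTwist_of_odd (h : OddTameUnitTwistOfPlusIndexPrimeToThree) :
    TameUnitTwistOfPlusIndexPrimeToThree := by
  intro N _ f hnew hQ h3 hd
  obtain ⟨m, hm, χ, r, hcop, hprim, hne, -, hord, hev, hr, hu⟩ := h f hnew hQ h3 hd
  exact ⟨m, hm, χ, r, hcop, hprim, hne, hord, hev, hr, hu⟩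

/-- **E-es-87± `ThreeAdicKPWitnessOfKPNeOneSquarefull`** — the KP witness law on the locus `ā(W) ≠ +1`
(Kosters–Pannekoek «never» or «quadratic-unramified-only» `3`-torsion in `Ê(𝔪)`) at squarefull level: THEOREM on paper
for `ā = 0` (all squarefull `N`) and for `ā = −1` when `4 ∣ N`; for `ā = −1` and odd `N` modulo B″ (see §3b). TYPER FRAMING (E-es-87±): lens es; LAW (obligation node), nothing asserted; BC5 and paper status in the module docstring; REF1
R-es-43 PENDING at filing.  OPEN in Lean.
[cite: KostersPannekoek2017, Thm. 1 (ii) (shape only: the K–P class ā; the law is the cell's E-es-87± — es MEMO-es §36)] -/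
@[conjecture]
def ThreeAdicKPWitnessOfKPNeOneSquarefull : Prop :=
  ∀ (W : WeierstrassCurve ℚ) [W.IsElliptic] [W.IsGloballyMinimal] {N : ℕ} [NeZero N]
    (D : ModularParametrizationData W N),
    (∀ z ∈ D.L.lattice, ∃ w ∈ periodLattice D.f, z = D.c * w) → 3 ^ 2 ∣ N → IsSquarefull N →
    kpSignThree W ≠ 1 → PlusIndexPrimeTo 3 D.f → ThreeAdicKPWitness W W D.f

/-- E-es-86 ⟹ E-es-87± (PROVED). -/
theorem e87pm_of_e86 (h : ThreeAdicKPWitnessOfPlusIndexPrimeToThree) : ThreeAdicKPWitnessOfKPNeOneSquarefull :=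
  fun W _ _ _ _ D hopt h9 _ _ hd ↦ h W D hopt h9 hd

/-- E-es-87± ⟹ E-es-87 (PROVED). -/
theorem e87_of_e87pm (h : ThreeAdicKPWitnessOfKPNeOneSquarefull) : ThreeAdicKPWitnessOfKPZeroSquarefull :=
  fun W _ _ _ _ D hopt h9 hsq h0 hd ↦ h W D hopt h9 hsq (by rw [h0]; norm_num) hd

/-! ## §4 The corollary: `3 ∤ c` on the Kim–Nakamura locus at composite squarefull level -/

/-- **COROLLARY (PROVED modulo the two named Props)**: E-es-87 and F₃♮ at `W` give `3 ∤ c` for every lattice-optimal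
`W` with `9 ∣ N`, `N` squarefull with a second prime `q ≠ 3`, `q² ∣ N` (this discharges the plus index by the tree's
`plusIndexPrimeTo_three_of_sq_dvd`), `ā(W) = 0`, and `Ω(W) = c·Ω⁺_f`, `c ≠ 0`. -/
theorem not_three_dvd_of_e87_of_kp (h87 : ThreeAdicKPWitnessOfKPZeroSquarefull)
    (W : WeierstrassCurve ℚ) [W.IsElliptic] [W.IsGloballyMinimal] {N : ℕ} [NeZero N]
    (D : ModularParametrizationData W N) (hF : KatoFactThreeAtKP W D.f)
    (hopt : ∀ z ∈ D.L.lattice, ∃ w ∈ periodLattice D.f, z = D.c * w)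
    (h9 : 3 ^ 2 ∣ N) (hsq : IsSquarefull N) (h0 : kpSignThree W = 0)
    {q : ℕ} (hq : q.Prime) (hq3 : q ≠ 3) (hqN : q ^ 2 ∣ N)
    (c : ℤ) (hΩ : W.realPeriodRat = (c : ℝ) * plusPeriod D.f) (hc0 : c ≠ 0) : ¬ 3 ∣ c :=
  not_three_dvd_of_katoFactThreeAtKP_of_kpWitness W W D.f c hF
    (h87 W D hopt h9 hsq h0 (plusIndexPrimeTo_three_of_sq_dvd D hq hq3 hqN)) hΩ hc0

/-- **COROLLARY in Manin currency (PROVED modulo the two named Props)**: `3 ∤ c(W)` (`D.c` = the Manin constant of the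
lattice-optimal parametrisation) on the Kim–Nakamura locus at composite squarefull level. -/
theorem not_three_dvd_maninConstant_of_e87_of_kp (h87 : ThreeAdicKPWitnessOfKPZeroSquarefull)
    (W : WeierstrassCurve ℚ) [W.IsElliptic] [W.IsGloballyMinimal] {N : ℕ} [NeZero N]
    (D : ModularParametrizationData W N) (hF : KatoFactThreeAtKP W D.f)
    (hopt : ∀ z ∈ D.L.lattice, ∃ w ∈ periodLattice D.f, z = D.c * w)
    (h9 : 3 ^ 2 ∣ N) (hsq : IsSquarefull N) (h0 : kpSignThree W = 0)
    {q : ℕ} (hq : q.Prime) (hq3 : q ≠ 3) (hqN : q ^ 2 ∣ N) : ¬ (3 : ℤ) ∣ D.c := by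
  have hΩ : W.realPeriodRat = ((|D.c| : ℤ) : ℝ) * plusPeriod D.f := by
    rw [Int.cast_abs]; exact D.realPeriodRat_eq_abs_mul_plusPeriod_of_latticeEq hopt
  have hc0 : D.c ≠ 0 := D.maninConstant_ne_zero_holds
  have h := not_three_dvd_of_e87_of_kp h87 W D hF hopt h9 hsq h0 hq hq3 hqN |D.c| hΩ (abs_ne_zero.mpr hc0)
  exact fun h3 => h ((dvd_abs 3 D.c).mpr h3)

/-- The same on the `E[3]`-IRREDUCIBLE locus from the Literature-shaped F₃♮ (PROVED modulo the two named Props). -/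
theorem not_three_dvd_maninConstant_of_e87_of_kp_irreducible (h87 : ThreeAdicKPWitnessOfKPZeroSquarefull)
    (hF : kato_neron_isIntegral_twistedSymbolSum_of_additive_three_kp)
    (W : WeierstrassCurve ℚ) [W.IsElliptic] [W.IsGloballyMinimal] {N : ℕ} [NeZero N]
    (D : ModularParametrizationData W N) (hirr : W.HasIrreducibleModPGaloisRep 3)
    (hopt : ∀ z ∈ D.L.lattice, ∃ w ∈ periodLattice D.f, z = D.c * w)
    (h9 : 3 ^ 2 ∣ N) (hsq : IsSquarefull N) (h0 : kpSignThree W = 0)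
    {q : ℕ} (hq : q.Prime) (hq3 : q ≠ 3) (hqN : q ^ 2 ∣ N) : ¬ (3 : ℤ) ∣ D.c :=
  not_three_dvd_maninConstant_of_e87_of_kp h87 W D (katoFactThreeAtKP_of_kp hF W D.f hirr) hopt h9 hsq h0 hq hq3 hqN

/-- **COROLLARY ± (PROVED modulo the two named Props)**: `3 ∤ c(W)` on the locus `ā(W) ≠ +1` at composite
squarefull level. -/
theorem not_three_dvd_maninConstant_of_e87pm_of_kp (h87 : ThreeAdicKPWitnessOfKPNeOneSquarefull)
    (W : WeierstrassCurve ℚ) [W.IsElliptic] [W.IsGloballyMinimal] {N : ℕ} [NeZero N]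
    (D : ModularParametrizationData W N) (hF : KatoFactThreeAtKP W D.f)
    (hopt : ∀ z ∈ D.L.lattice, ∃ w ∈ periodLattice D.f, z = D.c * w)
    (h9 : 3 ^ 2 ∣ N) (hsq : IsSquarefull N) (h1 : kpSignThree W ≠ 1)
    {q : ℕ} (hq : q.Prime) (hq3 : q ≠ 3) (hqN : q ^ 2 ∣ N) : ¬ (3 : ℤ) ∣ D.c := by
  have hΩ : W.realPeriodRat = ((|D.c| : ℤ) : ℝ) * plusPeriod D.f := by
    rw [Int.cast_abs]; exact D.realPeriodRat_eq_abs_mul_plusPeriod_of_latticeEq hopt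
  have hc0 : D.c ≠ 0 := D.maninConstant_ne_zero_holds
  have hd : PlusIndexPrimeTo 3 D.f := plusIndexPrimeTo_three_of_sq_dvd D hq hq3 hqN
  have hwit : ThreeAdicKPWitness W W D.f := h87 W D hopt h9 hsq h1 hd
  have h := not_three_dvd_of_katoFactThreeAtKP_of_kpWitness W W D.f |D.c| hF hwit hΩ (abs_ne_zero.mpr hc0)
  exact fun h3 => h ((dvd_abs 3 D.c).mpr h3)

/-! ## §5 The `ā = +1` hole and the class-blind case: DEGENERACY-LOOP PLUS INDICES (E-es-89 / E-es-90)

For `ā(W) = +1` the admissible characters at a prime conductor `ℓ` are those NON-TRIVIAL ON `⟨3̄⟩ ≤ (ℤ/ℓ)ˣ/±1`;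
the Fourier argument of §36.5 run relative to the subgroup `H = ⟨3̄⟩` shows: a KP witness of conductor `ℓ`
exists iff the plus period of some `U₃`-LOOP `{b/ℓ, 3b/ℓ}_f = {∞,3b/ℓ}_f − {∞,b/ℓ}_f` (an element of the tree's
`degeneracyLoops f 3`) is `≢ 0 (mod 3)` in units of the plus generator; with `H = ⟨9̄⟩` (characters non-trivial
on `⟨9̄⟩` have `χ(3) ∉ {±1}`: admissible for EVERY `ā`, and even POLAR-admissible) the same holds with ratio `9`.
Since `H₁(X₀(tN),ℤ)` is generated by the symbols `{0, b/ℓ}` with `ℓ` PRIME `≡ 2 (mod 3)` (signed Dirichlet move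
`{0,b/d} = {0, b/(d + tN·b·k)}`, `k ∈ ℤ`), the hypothesis needed is exactly a PLUS-INDEX condition on the closure of
the degeneracy loops — per `f`, checkable, and implied by (but much weaker than) the lattice law E-es-68. -/

/-- The plus part of the closure of the ratio-`t` degeneracy loops has index prime to `p` in the plus part of
`Λ_f` (shape of the tree's `PlusIndexPrimeTo`, with `periodLatticeGamma1 f` replaced by
`AddSubgroup.closure (degeneracyLoops f t)`). -/
def DegeneracyPlusIndexPrimeTo (p t : ℕ) {N : ℕ} (f : CuspForm (Gamma0 N) 2) : Prop :=
  ∀ x ∈ periodLattice f, ∃ y ∈ AddSubgroup.closure (Summit.BirchSwinnertonDyer.Rank1Residual.ManinAdditive.Gamma1Lattice.degeneracyLoops f t), ∃ k : ℕ, ¬ p ∣ k ∧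
    (k : ℂ) * (x + starRingEnd ℂ x) = y + starRingEnd ℂ y

/-- Under the ratio-`9` lattice law E-es-68₉ the two plus-index conditions coincide (PROVED, one direction
suffices for the cell). -/
theorem degeneracyPlusIndexPrimeTo_nine_of_law (hlaw : Summit.BirchSwinnertonDyer.Rank1Residual.ManinAdditive.Gamma1Lattice.DegeneracyLoopLawNine)
    {p N : ℕ} [NeZero N] (h9 : 3 ^ 2 ∣ N) (f : CuspForm (Gamma0 N) 2) (hd : PlusIndexPrimeTo p f) :
    DegeneracyPlusIndexPrimeTo p 9 f := by
  intro x hx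
  obtain ⟨y, hy, k, hk, hxy⟩ := hd x hx
  exact ⟨y, by rw [hlaw h9 f]; exact hy, k, hk, hxy⟩

/-- **E-es-89 `ThreeAdicKPWitnessOfDegeneracyThreePlusIndex`** — the `ā ≠ −1` law at squarefull level from the
ratio-`3` plus index: THEOREM on paper (MEMO-es §36.11: generation of `H₁(X₀(3N),ℤ)` by prime symbols
`ℓ ≡ 2 (mod 3)` + Fourier inversion relative to `H = ⟨3̄⟩`).  Together with E-es-87± it covers EVERY K–P class at
squarefull level, the `ā = +1` classes at the price of the ratio-`3` index instead of the Shimura plus index. TYPER FRAMING (E-es-89): lens es; LAW (obligation node), nothing asserted; THEOREM on paper (MEMO-es §36.11 THEOREM U); REF1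
R-es-43 (scope += §36.11) PENDING at filing.  OPEN in Lean.
[cite: KostersPannekoek2017, Thm. 1 (ii) (shape only; the law is the cell's E-es-89 — es MEMO-es §36.11)] -/
@[conjecture]
def ThreeAdicKPWitnessOfDegeneracyThreePlusIndex : Prop :=
  ∀ (W : WeierstrassCurve ℚ) [W.IsElliptic] [W.IsGloballyMinimal] {N : ℕ} [NeZero N]
    (D : ModularParametrizationData W N),
    (∀ z ∈ D.L.lattice, ∃ w ∈ periodLattice D.f, z = D.c * w) → 3 ^ 2 ∣ N → IsSquarefull N →
    kpSignThree W ≠ -1 → DegeneracyPlusIndexPrimeTo 3 3 D.f → ThreeAdicKPWitness W W D.f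

/-- **E-es-90 `ThreeAdicPolarWitnessOfDegeneracyNinePlusIndex`** — CLASS-BLIND and POLAR: at squarefull level the
ratio-`9` plus index gives the ORIGINAL polar witness of E-es-66 (characters non-trivial on `⟨9̄⟩` have
`χ(3) ∉ {±1}`).  THEOREM on paper (§36.11).  With E-es-68₉ this is E-es-66 on the squarefull locus
(PROVED edge below) — the f-specific plus index replaces the lattice law. TYPER FRAMING (E-es-90): lens es; LAW (obligation node), nothing asserted; THEOREM on paper (MEMO-es §36.11 THEOREM U); REF1
R-es-43 (scope += §36.11) PENDING at filing.  OPEN in Lean.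
[cite: KostersPannekoek2017, Thm. 1 (ii) (shape only; the law is the cell's E-es-90 — es MEMO-es §36.11)] -/
@[conjecture]
def ThreeAdicPolarWitnessOfDegeneracyNinePlusIndex : Prop :=
  ∀ (W : WeierstrassCurve ℚ) [W.IsElliptic] [W.IsGloballyMinimal] {N : ℕ} [NeZero N]
    (D : ModularParametrizationData W N),
    (∀ z ∈ D.L.lattice, ∃ w ∈ periodLattice D.f, z = D.c * w) → 3 ^ 2 ∣ N → IsSquarefull N →
    DegeneracyPlusIndexPrimeTo 3 9 D.f → ThreeAdicPolarWitness W W D.f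

/-- E-es-90 ∧ E-es-68₉ ⟹ E-es-66 on the squarefull locus (PROVED). -/
theorem polarWitness_of_e90_of_lawNine (h90 : ThreeAdicPolarWitnessOfDegeneracyNinePlusIndex)
    (hlaw : Summit.BirchSwinnertonDyer.Rank1Residual.ManinAdditive.Gamma1Lattice.DegeneracyLoopLawNine)
    (W : WeierstrassCurve ℚ) [W.IsElliptic] [W.IsGloballyMinimal] {N : ℕ} [NeZero N]
    (D : ModularParametrizationData W N)
    (hopt : ∀ z ∈ D.L.lattice, ∃ w ∈ periodLattice D.f, z = D.c * w) (h9 : 3 ^ 2 ∣ N)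
    (hsq : IsSquarefull N) (hd : PlusIndexPrimeTo 3 D.f) : ThreeAdicPolarWitness W W D.f :=
  h90 W D hopt h9 hsq (degeneracyPlusIndexPrimeTo_nine_of_law hlaw h9 D.f hd)

/-- E-es-90 ⟹ the squarefull KP law for every class, from the ratio-`9` index (PROVED edge). -/
theorem kpWitness_of_e90 (h90 : ThreeAdicPolarWitnessOfDegeneracyNinePlusIndex)
    (W : WeierstrassCurve ℚ) [W.IsElliptic] [W.IsGloballyMinimal] {N : ℕ} [NeZero N]
    (D : ModularParametrizationData W N)
    (hopt : ∀ z ∈ D.L.lattice, ∃ w ∈ periodLattice D.f, z = D.c * w) (h9 : 3 ^ 2 ∣ N)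
    (hsq : IsSquarefull N) (hd : DegeneracyPlusIndexPrimeTo 3 9 D.f) : ThreeAdicKPWitness W W D.f :=
  kpWitness_of_polar W W D.f (h90 W D hopt h9 hsq hd)

/-- **COROLLARY (PROVED modulo the named Props)**: `3 ∤ c(W)` for `ā(W) = +1` at composite squarefull level from
the ratio-`3` plus index. -/
theorem not_three_dvd_maninConstant_of_e89_of_kp (h89 : ThreeAdicKPWitnessOfDegeneracyThreePlusIndex)
    (W : WeierstrassCurve ℚ) [W.IsElliptic] [W.IsGloballyMinimal] {N : ℕ} [NeZero N]
    (D : ModularParametrizationData W N) (hF : KatoFactThreeAtKP W D.f)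
    (hopt : ∀ z ∈ D.L.lattice, ∃ w ∈ periodLattice D.f, z = D.c * w)
    (h9 : 3 ^ 2 ∣ N) (hsq : IsSquarefull N) (h1 : kpSignThree W ≠ -1)
    (hd3 : DegeneracyPlusIndexPrimeTo 3 3 D.f) : ¬ (3 : ℤ) ∣ D.c := by
  have hΩ : W.realPeriodRat = ((|D.c| : ℤ) : ℝ) * plusPeriod D.f := by
    rw [Int.cast_abs]; exact D.realPeriodRat_eq_abs_mul_plusPeriod_of_latticeEq hopt
  have hc0 : D.c ≠ 0 := D.maninConstant_ne_zero_holds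
  have hwit : ThreeAdicKPWitness W W D.f := h89 W D hopt h9 hsq h1 hd3
  have h := not_three_dvd_of_katoFactThreeAtKP_of_kpWitness W W D.f |D.c| hF hwit hΩ (abs_ne_zero.mpr hc0)
  exact fun h3 => h ((dvd_abs 3 D.c).mpr h3)

end Summit.BirchSwinnertonDyer.Rank1Residual.ManinAdditive.KatoCurve

end
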